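import Summits.CriticalPhenomena.CardyFormulaZ2.Theorems.CardyBoundaryCoulombGasHalfPlaneMarkDensityLawNENearRightWindow
import Summits.CriticalPhenomena.CardyFormulaZ2.Theorems.CardyBoundaryCoulombGasHalfPlaneMarkDensityLawNENearRightShift
import Summits.CriticalPhenomena.CardyFormulaZ2.Theorems.CardyBoundaryCoulombGasHalfPlaneMarkDensityLawNENearRightLower
import Summits.CriticalPhenomena.CardyFormulaZ2.Theorems.CardyBoundaryCoulombGasHalfPlaneMarkDensityLawNENearEndOfCluster
import Summits.CriticalPhenomena.CardyFormulaZ2.Theorems.CardyBoundaryCoulombGasHalfPlaneMarkDensityLawNEDecoupling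
import Summits.CriticalPhenomena.CardyFormulaZ2.Theorems.CardyBoundaryCoulombGasHalfPlaneMarkDensityLawNENearEndPositivityOf
import Summits.CriticalPhenomena.CardyFormulaZ2.Theorems.CardyBoundaryCoulombGasHalfPlaneMarkDensityLawPosHClusterToolkit
import Summits.CriticalPhenomena.CardyFormulaZ2.Theorems.CardyBoundaryCoulombGasHalfPlaneMarkDensityLawPosDensityPositivity
import Summits.CriticalPhenomena.CardyFormulaZ2.Theorems.CardyBoundaryCoulombGasHalfPlaneMarkDensityLawNearEndRegularity

/-!
# `HalfPlaneMarkDensityLaw` (crux stmt-CriticalPhenomena-5661), line `Sketch`, cycle 5 (`NearEndPos`), lead c12-0: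
# assembly — **the near-end mark density is bounded below; ALL FOUR partial derivatives of every joint
# subsequential limit are nonzero at every chamber point**

`NE_n = firstHit halfPlane ([⌊cn⌋,⌊yn⌋]×{0}) ⌊an⌋ ⌊bn⌋` is the lattice derivative of `P_n(a,b,c,y)` in the second
mark; `θ j · P[NE_{θ j}] → ∂₂G` (c4-0).  Composition of the landed stubs of `Lines/Sketch_NearEndPos.lean`
(second-mark window counting `stub_nearRight_of_window2` p133060 + translation `stub_nearRight_shift` p133047 ⇒
`stub_nearRight_lowerBound`; `H`-cluster decoupling `stub_nearEnd_of_hCluster` + toolkit of cycle 4 ⇒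
`stub_nearEnd_decoupling`; BelowOne ⇒ `stub_nearEndDensityPositivity`), and the consequences for every joint
subsequential limit `G` along a strictly increasing `θ`: `∂₂G > 0` (`deriv_jointLimit_second_pos`) and, by the
lattice reflection, `∂₃G < 0` (`deriv_jointLimit_third_neg`) at EVERY chamber point; with cycle 4
(`Positivity.deriv_jointLimit_pos`, `Positivity.deriv_jointLimit_first_neg`): **`∂₁G < 0 < ∂₂G`, `∂₃G < 0 < ∂₄G`
everywhere on the chamber** (`jointLimit_partials_sign`).  No arm separation is used anywhere.
-/

noncomputable section

namespace Summit.CriticalPhenomena.CardyFormulaZ2.Cruxes.HalfPlaneMarkDensityLaw.SketchLine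

open Literature.Probability.Percolation Literature.Probability.LatticeModels
open MeasureTheory Filter Set SimpleGraph
open scoped Topology
open Summit.CriticalPhenomena.CardyFormulaZ2.Theorems.HalfPlaneMarkDensityLaw.Negative

namespace NearEndPos

/-- **N3. `n · P[NR(⌊bn⌋; ⌊cn⌋, ⌊yn⌋; ⌊an⌋)] ≥ c₀ > 0` eventually** (`a < b < c < y`). [folklore] -/
theorem stub_nearRight_lowerBound :
    ∀ (a b c y : ℝ), a < b → b < c → c < y → ∃ c₀ : ℝ, 0 < c₀ ∧ ∀ᶠ n : ℕ in atTop, c₀ ≤ (n : ℝ) * μ.real {ω : BondConfig (Site 2) | (∃ r : ℤ, ⌊c * n⌋ ≤ r ∧ r ≤ ⌊y * n⌋ ∧ ω ∈ openConnIn halfPlane (bpt (⌊b * n⌋)) (bpt r)) ∧ ∀ s : ℤ, ⌊a * n⌋ ≤ s → s < ⌊b * n⌋ → ω ∉ openConnIn halfPlane (bpt (⌊b * n⌋)) (bpt s)} :=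
  stub_nearRight_lowerBound_of stub_nearRight_of_window2 stub_nearRight_shift

/-- **N8. Near-end decoupling: `(1 − q)·P[NR(k; clo, chi; alo)] ≤ P[firstHit halfPlane ([clo,chi]×{0}) alo k]`**
if the escape crossing `[alo,k)×{0} ↔ [clo,chi]×{0}` has probability `≤ q`. [folklore] -/
theorem stub_nearEnd_decoupling :
    ∀ (k alo clo chi : ℤ) (q : ℝ), alo ≤ k → k < clo → clo ≤ chi → μ.real (openCrossing halfPlane (rowIco alo k) (rowIcc clo chi)) ≤ q → (1 - q) * μ.real {ω : BondConfig (Site 2) | (∃ r : ℤ, clo ≤ r ∧ r ≤ chi ∧ ω ∈ openConnIn halfPlane (bpt (k)) (bpt r)) ∧ ∀ s : ℤ, alo ≤ s → s < k → ω ∉ openConnIn halfPlane (bpt (k)) (bpt s)} ≤ μ.real (firstHit halfPlane (rowIcc clo chi) alo k) :=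
  stub_nearEnd_decoupling_of stub_nearEnd_of_hCluster Positivity.stub_mem_hCluster_iff
    Positivity.stub_hCluster_indep Positivity.stub_hCluster_measurable

/-- **N9. POSITIVITY OF THE NEAR-END MARK DENSITY**: for `a < b < c < y` there is `c₁ > 0` with
`c₁ ≤ n · P_{1/2}[NE_n(a,b,c,y)]` for all large `n`. [folklore] -/
theorem stub_nearEndDensityPositivity :
    ∀ (a b c y : ℝ), a < b → b < c → c < y → ∃ c₁ : ℝ, 0 < c₁ ∧ ∀ᶠ n : ℕ in atTop, c₁ ≤ (n : ℝ) * μ.real (firstHit halfPlane (rowIcc ⌊c * n⌋ ⌊y * n⌋) ⌊a * n⌋ ⌊b * n⌋) :=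
  stub_nearEndDensityPositivity_of stub_nearRight_lowerBound stub_nearEnd_decoupling

/-- **`∂₂G > 0` at every chamber point**, for every joint subsequential scaling limit `G` of the half-plane
four-arc crossing probability of critical bond-`ℤ²`. [folklore] -/
theorem deriv_jointLimit_second_pos {θ : ℕ → ℕ} {G : ℝ → ℝ → ℝ → ℝ → ℝ}
    (hG : ∀ a b c y : ℝ, a < b → b < c → c < y →
      Tendsto (fun n ↦ μ.real (openCrossing halfPlane (arcA a b (θ n))
        (rowIcc ⌊c * (θ n : ℕ)⌋ ⌊y * (θ n : ℕ)⌋))) atTop (𝓝 (G a b c y)))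
    (hθ : StrictMono θ) {a b c y : ℝ} (hab : a < b) (hbc : b < c) (hcy : c < y) :
    0 < deriv (fun s ↦ G a s c y) b := by
  obtain ⟨c₁, hc₁, hev⟩ := stub_nearEndDensityPositivity a b c y hab hbc hcy
  have hlim := (NearEnd.hasDerivAt_jointLimit_second hG hθ.tendsto_atTop hab hbc hcy).2
  exact lt_of_lt_of_le hc₁ (ge_of_tendsto hlim (hθ.tendsto_atTop.eventually hev))

/-- **`∂₃G < 0` at every chamber point** (`∂₃G(a,b,c,y) = −∂₂G(−y,−c,−b,−a)`, lattice reflection). [folklore] -/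
theorem deriv_jointLimit_third_neg {θ : ℕ → ℕ} {G : ℝ → ℝ → ℝ → ℝ → ℝ}
    (hG : ∀ a b c y : ℝ, a < b → b < c → c < y →
      Tendsto (fun n ↦ μ.real (openCrossing halfPlane (arcA a b (θ n))
        (rowIcc ⌊c * (θ n : ℕ)⌋ ⌊y * (θ n : ℕ)⌋))) atTop (𝓝 (G a b c y)))
    (hθ : StrictMono θ) {a b c y : ℝ} (hab : a < b) (hbc : b < c) (hcy : c < y) :
    deriv (fun s ↦ G a b s y) c < 0 := by
  rw [(NearEnd.hasDerivAt_jointLimit_third hG hθ hab hbc hcy).deriv]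
  have h := deriv_jointLimit_second_pos hG hθ (a := -y) (b := -c) (c := -b) (y := -a)
    (by linarith) (by linarith) (by linarith)
  linarith

/-- **All four partial derivatives of every joint subsequential limit are nonzero, with the signs of a crossing
probability, at EVERY point of the chamber**: `∂₁G < 0`, `∂₂G > 0`, `∂₃G < 0`, `∂₄G > 0`. [folklore] -/
theorem jointLimit_partials_sign {θ : ℕ → ℕ} {G : ℝ → ℝ → ℝ → ℝ → ℝ}
    (hG : ∀ a b c y : ℝ, a < b → b < c → c < y →
      Tendsto (fun n ↦ μ.real (openCrossing halfPlane (arcA a b (θ n))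
        (rowIcc ⌊c * (θ n : ℕ)⌋ ⌊y * (θ n : ℕ)⌋))) atTop (𝓝 (G a b c y)))
    (hθ : StrictMono θ) {a b c y : ℝ} (hab : a < b) (hbc : b < c) (hcy : c < y) :
    deriv (fun s ↦ G s b c y) a < 0 ∧ 0 < deriv (fun s ↦ G a s c y) b ∧
      deriv (fun s ↦ G a b s y) c < 0 ∧ 0 < deriv (G a b c) y :=
  ⟨Positivity.deriv_jointLimit_first_neg hG hθ hab hbc hcy, deriv_jointLimit_second_pos hG hθ hab hbc hcy,
    deriv_jointLimit_third_neg hG hθ hab hbc hcy, Positivity.deriv_jointLimit_pos hG hθ hab hbc hcy⟩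

end NearEndPos

end Summit.CriticalPhenomena.CardyFormulaZ2.Cruxes.HalfPlaneMarkDensityLaw.SketchLine
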